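import Mathlib
import HarnessLib
import Summits.KontsevichZagierPeriods.Zeta5Search.TwoTaleWhipple
import Summits.KontsevichZagierPeriods.Zeta5Search.TwoTaleWhippleBinomial

/-!
# TwoTaleWhippleRemark5 — Zudilin's Remark 5 (Whipple) PROVED on the cone `a₁, a₂, a₃ ≤ a₄`

HONEST FRAMING: systematic search; no irrationality claim unless certified.

fam-measure (pub-zeta5), FAMILY.md §10.11, successor task G1 (last third).  For Remark-5 data
`a = (a₁, a₂, a₃, a₄)`, `b = (1, a₄−a₁+1, a₄−a₂+1, b₄)` (admissible, with `a₁, a₂, a₃ ≤ a₄`) and its Whipple partner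
`â = (b₄−a₃+a₄; a₂, a₁, a₄)`, `b̂ = (a₄+1; a₄−a₃+1, a₁+a₂, b₄)` we identify the Literature's integer mirrors with
the two binomial sums of `TwoTaleWhippleBinomial.binomialWhipple`:

* (E1) `formQZ a b = (−1)^(N+1) · Σ_(n≤N) (−1)^n C(N,n) C(n+x+y+e, y+e) C(n+y+e, e) C(n+x+e, e')`
  (`formQZ_first`; `amax a = a₄`, `k = a₄ + n`, `ε_k = (−1)^n C(N,n)`, `zb lo hi (−k) = (−1)^(hi−lo) C(k−lo, hi−lo)`),
* (E2) `formQTZ â b̂ = Σ_(r≤N) C(x+y+e+2r, N+z) C(r+y+e', e') C(x+e, x+r) C(N, r)` (`formQTZ_hat`; `k = a₄ + r`,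
  the guard `2k < â₀` is exactly the vanishing of the first binomial, the range `[a₄, min(a₁+a₂, b₄))` extends
  to `r ≤ N` because `C(x+e, x+r) = 0` for `r > e`),

where `x = a₄−a₁, y = a₄−a₂, z = a₄−a₃, e = a₁+a₂−a₄−1, e' = a₂+a₃−a₄−1, N = b₄−a₄−1`.  Hence
**`remark5Max : formQZ a b = −formQTZ â b̂`** on that cone, i.e. the named input
`TwoTaleWhippleP15.WhippleRemark5Max` of the two-tale measure bounds holds outright (the one-line bridge
`whippleRemark5Max_holds` lives in the follow-up file importing `TwoTaleWhippleP15`).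
-/

namespace Summit.KontsevichZagierPeriods.Zeta5Search.TwoTaleWhippleRemark5

open Finset
open Literature.NumberTheory.Irrationality.Zudilin2014
open Summit.KontsevichZagierPeriods.Zeta5Search.TwoTaleWhipple (firstA firstB hatA hatB)
open Summit.KontsevichZagierPeriods.Zeta5Search.TwoTaleWhippleBinomial (binomialWhipple)

/-! ### Two bookkeeping lemmas -/

/-- Reindex a sum over an integer interval `[lo, lo+m)` by `range m`. -/
theorem sum_Ico_int_eq_sum_range (lo : ℤ) (m : ℕ) (f : ℤ → ℤ) :
    ∑ i ∈ Ico lo (lo + m), f i = ∑ j ∈ range m, f (lo + j) := by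
  have himage : Ico lo (lo + m) = (range m).image fun j : ℕ => lo + j := by
    ext i
    simp only [mem_Ico, mem_image, mem_range]
    constructor
    · rintro ⟨h1, h2⟩; exact ⟨(i - lo).toNat, by omega, by omega⟩
    · rintro ⟨j, hj, rfl⟩; omega
  have hinj : Set.InjOn (fun j : ℕ => lo + (j : ℤ)) (range m : Finset ℕ) := by
    intro x _ y _ hxy
    have : (x : ℤ) = y := by dsimp at hxy; linarith
    exact_mod_cast this
  rw [himage, sum_image hinj]

/-- The integer block value at a pole: `zb lo hi (−k) = (−1)^(hi−lo) C(k−lo, hi−lo)` for `lo ≤ hi ≤ k`. -/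
theorem zb_neg_of_le (lo hi k : ℤ) (hlh : lo ≤ hi) (hk : hi ≤ k) :
    zb lo hi (-k) = (-1) ^ (hi - lo).toNat * ((Nat.choose (k - lo).toNat (hi - lo).toNat : ℕ) : ℤ) := by
  unfold zb
  have e1 : k - hi + 1 + (((hi - lo).toNat : ℕ) : ℤ) - 1 = (((k - lo).toNat : ℕ) : ℤ) := by omega
  rw [show -k + hi - 1 = -(k - hi + 1) by ring, Ring.choose_neg, e1, Ring.choose_natCast, Units.smul_def,
    Int.coe_negOnePow_natCast, smul_eq_mul]

/-! ### (E1) the first tale -/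

section remark5
variable {a₁ a₂ a₃ a₄ b₄ : ℤ}

/-- The summand `C_k`, `k = a₄ + n`, of the first tale at Remark-5 data on the cone. -/
theorem coefCZ_first (h₁ : a₁ ≤ a₄) (h₂ : a₂ ≤ a₄) (h₃ : a₃ ≤ a₄)
    (hadm : Admissible (firstA a₁ a₂ a₃ a₄) (firstB a₁ a₂ a₄ b₄)) (n : ℕ) :
    coefCZ (firstA a₁ a₂ a₃ a₄) (firstB a₁ a₂ a₄ b₄) (a₄ + n) =
      (-1) ^ ((a₁ - 1).toNat + (a₁ + a₂ - a₄ - 1).toNat + (a₂ + a₃ - a₄ - 1).toNat) *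
        ((-1) ^ n * ((Nat.choose (b₄ - a₄ - 1).toNat n : ℕ) : ℤ) *
          ((Nat.choose (n + ((a₄ - a₁).toNat + (a₄ - a₂).toNat + (a₁ + a₂ - a₄ - 1).toNat))
              ((a₄ - a₂).toNat + (a₁ + a₂ - a₄ - 1).toNat) : ℕ) : ℤ) *
          ((Nat.choose (n + ((a₄ - a₂).toNat + (a₁ + a₂ - a₄ - 1).toNat)) (a₁ + a₂ - a₄ - 1).toNat : ℕ) : ℤ) *
          ((Nat.choose (n + ((a₄ - a₁).toNat + (a₁ + a₂ - a₄ - 1).toNat)) (a₂ + a₃ - a₄ - 1).toNat : ℕ) : ℤ)) := by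
  have l00 := hadm.lower 0 (by decide) 0
  have l11 := hadm.lower 1 (by decide) 1
  have l22 := hadm.lower 2 (by decide) 2
  simp only [TwoTaleWhipple.firstA_zero, TwoTaleWhipple.firstA_one, TwoTaleWhipple.firstA_two,
    TwoTaleWhipple.firstB_zero, TwoTaleWhipple.firstB_one, TwoTaleWhipple.firstB_two] at l00 l11 l22
  unfold coefCZ epsZ zR1
  simp only [TwoTaleWhipple.firstA_zero, TwoTaleWhipple.firstA_one, TwoTaleWhipple.firstA_two,
    TwoTaleWhipple.firstA_three, TwoTaleWhipple.firstB_zero, TwoTaleWhipple.firstB_one,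
    TwoTaleWhipple.firstB_two, TwoTaleWhipple.firstB_three]
  rw [zb_neg_of_le 1 a₁ (a₄ + n) (by omega) (by omega),
    zb_neg_of_le (a₄ - a₁ + 1) a₂ (a₄ + n) (by omega) (by omega),
    zb_neg_of_le (a₄ - a₂ + 1) a₃ (a₄ + n) (by omega) (by omega)]
  have t0 : (a₄ + (n : ℤ) - a₄).toNat = n := by omega
  have t1 : (a₄ + (n : ℤ) - 1).toNat = n + ((a₄ - a₁).toNat + (a₄ - a₂).toNat + (a₁ + a₂ - a₄ - 1).toNat) := by
    omega
  have t1' : (a₁ - 1).toNat = (a₄ - a₂).toNat + (a₁ + a₂ - a₄ - 1).toNat := by omega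
  have t2 : (a₄ + (n : ℤ) - (a₄ - a₁ + 1)).toNat = n + ((a₄ - a₂).toNat + (a₁ + a₂ - a₄ - 1).toNat) := by omega
  have t2' : (a₂ - (a₄ - a₁ + 1)).toNat = (a₁ + a₂ - a₄ - 1).toNat := by omega
  have t3 : (a₄ + (n : ℤ) - (a₄ - a₂ + 1)).toNat = n + ((a₄ - a₁).toNat + (a₁ + a₂ - a₄ - 1).toNat) := by omega
  have t3' : (a₃ - (a₄ - a₂ + 1)).toNat = (a₂ + a₃ - a₄ - 1).toNat := by omega
  rw [t0, t1, t2, t2', t3, t3']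
  rw [t1'] -- only the remaining occurrence (the exponent/second argument of the first block)
  ring

/-- **(E1)** `formQZ a b = (−1)^(N+1) Σ_n T_n` at Remark-5 data on the cone. -/
theorem formQZ_first (h₁ : a₁ ≤ a₄) (h₂ : a₂ ≤ a₄) (h₃ : a₃ ≤ a₄)
    (hadm : Admissible (firstA a₁ a₂ a₃ a₄) (firstB a₁ a₂ a₄ b₄)) :
    formQZ (firstA a₁ a₂ a₃ a₄) (firstB a₁ a₂ a₄ b₄) =
      (-1) ^ ((b₄ - a₄ - 1).toNat + 1) * ∑ n ∈ range ((b₄ - a₄ - 1).toNat + 1),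
        (-1 : ℤ) ^ n * ((Nat.choose (b₄ - a₄ - 1).toNat n : ℕ) : ℤ) *
          ((Nat.choose (n + ((a₄ - a₁).toNat + (a₄ - a₂).toNat + (a₁ + a₂ - a₄ - 1).toNat))
              ((a₄ - a₂).toNat + (a₁ + a₂ - a₄ - 1).toNat) : ℕ) : ℤ) *
          ((Nat.choose (n + ((a₄ - a₂).toNat + (a₁ + a₂ - a₄ - 1).toNat)) (a₁ + a₂ - a₄ - 1).toNat : ℕ) : ℤ) *
          ((Nat.choose (n + ((a₄ - a₁).toNat + (a₁ + a₂ - a₄ - 1).toNat)) (a₂ + a₃ - a₄ - 1).toNat : ℕ) : ℤ) := by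
  have l00 := hadm.lower 0 (by decide) 0
  have l11 := hadm.lower 1 (by decide) 1
  have l22 := hadm.lower 2 (by decide) 2
  have u3 := hadm.upper 3
  have hbal := hadm.balance
  simp only [TwoTaleWhipple.firstA_zero, TwoTaleWhipple.firstA_one, TwoTaleWhipple.firstA_two,
    TwoTaleWhipple.firstA_three, TwoTaleWhipple.firstB_zero, TwoTaleWhipple.firstB_one,
    TwoTaleWhipple.firstB_two, TwoTaleWhipple.firstB_three, Fin.sum_univ_four] at l00 l11 l22 u3 hbal
  have hamax : amax (firstA a₁ a₂ a₃ a₄) = a₄ := by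
    simp only [amax, TwoTaleWhipple.firstA_zero, TwoTaleWhipple.firstA_one, TwoTaleWhipple.firstA_two,
      TwoTaleWhipple.firstA_three]
    omega
  have hd : dExp (firstA a₁ a₂ a₃ a₄) (firstB a₁ a₂ a₄ b₄) = (2 * a₁ + 2 * a₂ + a₃ - a₄ - 3 - b₄).toNat := by
    simp only [dExp, TwoTaleWhipple.firstA_zero, TwoTaleWhipple.firstA_one, TwoTaleWhipple.firstA_two,
      TwoTaleWhipple.firstA_three, TwoTaleWhipple.firstB_zero, TwoTaleWhipple.firstB_one,
      TwoTaleWhipple.firstB_two, TwoTaleWhipple.firstB_three, Fin.sum_univ_four]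
    congr 1; ring
  unfold formQZ
  rw [hd, hamax, TwoTaleWhipple.firstB_three,
    show Ico a₄ b₄ = Ico a₄ (a₄ + ((((b₄ - a₄ - 1).toNat + 1 : ℕ)) : ℤ)) by congr 1; omega,
    sum_Ico_int_eq_sum_range, Finset.mul_sum, Finset.mul_sum]
  refine Finset.sum_congr rfl fun n hn => ?_
  rw [coefCZ_first h₁ h₂ h₃ hadm n]
  -- signs: d + (a₁−1) + e + e' = (N+1) + 2d
  have hS : (2 * a₁ + 2 * a₂ + a₃ - a₄ - 3 - b₄).toNat + ((a₁ - 1).toNat + (a₁ + a₂ - a₄ - 1).toNat +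
      (a₂ + a₃ - a₄ - 1).toNat) = ((b₄ - a₄ - 1).toNat + 1) + 2 * (2 * a₁ + 2 * a₂ + a₃ - a₄ - 3 - b₄).toNat := by
    omega
  have hsign : ((-1 : ℤ) ^ (2 * a₁ + 2 * a₂ + a₃ - a₄ - 3 - b₄).toNat) *
      (-1) ^ ((a₁ - 1).toNat + (a₁ + a₂ - a₄ - 1).toNat + (a₂ + a₃ - a₄ - 1).toNat) =
      (-1) ^ ((b₄ - a₄ - 1).toNat + 1) := by
    rw [← pow_add, hS, pow_add, pow_mul]; norm_num
  rw [← mul_assoc, hsign]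

/-! ### (E2) the second tale -/

/-- The summand `A_k`, `k = a₄ + r`, of the second tale at the Whipple partner of Remark-5 data on the cone. -/
theorem coefATZ_hat (h₁ : a₁ ≤ a₄) (h₂ : a₂ ≤ a₄) (h₃ : a₃ ≤ a₄)
    (hadm : Admissible (firstA a₁ a₂ a₃ a₄) (firstB a₁ a₂ a₄ b₄)) (r : ℕ) :
    coefATZ (hatA a₁ a₂ a₃ a₄ b₄) (hatB a₁ a₂ a₃ a₄ b₄) (a₄ + r) =
      (-1) ^ (((b₄ - a₄ - 1).toNat + (a₄ - a₃).toNat) + (a₂ + a₃ - a₄ - 1).toNat + (a₄ - a₁).toNat) *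
        (((Nat.choose ((a₄ - a₁).toNat + (a₄ - a₂).toNat + (a₁ + a₂ - a₄ - 1).toNat + 2 * r)
              ((b₄ - a₄ - 1).toNat + (a₄ - a₃).toNat) : ℕ) : ℤ) *
          ((Nat.choose (r + ((a₄ - a₂).toNat + (a₂ + a₃ - a₄ - 1).toNat)) (a₂ + a₃ - a₄ - 1).toNat : ℕ) : ℤ) *
          ((Nat.choose ((a₄ - a₁).toNat + (a₁ + a₂ - a₄ - 1).toNat) ((a₄ - a₁).toNat + r) : ℕ) : ℤ) *
          ((Nat.choose (b₄ - a₄ - 1).toNat r : ℕ) : ℤ)) := by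
  have l00 := hadm.lower 0 (by decide) 0
  have l11 := hadm.lower 1 (by decide) 1
  have l22 := hadm.lower 2 (by decide) 2
  have u3 := hadm.upper 3
  simp only [TwoTaleWhipple.firstA_zero, TwoTaleWhipple.firstA_one, TwoTaleWhipple.firstA_two,
    TwoTaleWhipple.firstA_three, TwoTaleWhipple.firstB_zero, TwoTaleWhipple.firstB_one,
    TwoTaleWhipple.firstB_two, TwoTaleWhipple.firstB_three] at l00 l11 l22 u3
  unfold coefATZ
  simp only [TwoTaleWhipple.hatA_zero, TwoTaleWhipple.hatA_one, TwoTaleWhipple.hatA_two,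
    TwoTaleWhipple.hatA_three, TwoTaleWhipple.hatB_zero, TwoTaleWhipple.hatB_one, TwoTaleWhipple.hatB_two,
    TwoTaleWhipple.hatB_three]
  by_cases hg : 2 * (a₄ + (r : ℤ)) < b₄ - a₃ + a₄
  · rw [if_pos hg, Nat.choose_eq_zero_of_lt (n := (a₄ - a₁).toNat + (a₄ - a₂).toNat +
      (a₁ + a₂ - a₄ - 1).toNat + 2 * r) (by omega)]
    simp
  · rw [if_neg hg]
    have t1 : (2 * (a₄ + (r : ℤ)) - (a₄ + 1)).toNat =
        (a₄ - a₁).toNat + (a₄ - a₂).toNat + (a₁ + a₂ - a₄ - 1).toNat + 2 * r := by omega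
    have t1' : (b₄ - a₃ + a₄ - (a₄ + 1)).toNat = (b₄ - a₄ - 1).toNat + (a₄ - a₃).toNat := by omega
    have t2 : (a₄ + (r : ℤ) - (a₄ - a₃ + 1)).toNat = r + ((a₄ - a₂).toNat + (a₂ + a₃ - a₄ - 1).toNat) := by
      omega
    have t2' : (a₂ - (a₄ - a₃ + 1)).toNat = (a₂ + a₃ - a₄ - 1).toNat := by omega
    have t3 : (a₁ + a₂ - a₁ - 1).toNat = (a₄ - a₁).toNat + (a₁ + a₂ - a₄ - 1).toNat := by omega
    have t3' : (a₄ + (r : ℤ) - a₁).toNat = (a₄ - a₁).toNat + r := by omega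
    have t4' : (a₄ + (r : ℤ) - a₄).toNat = r := by omega
    rw [t1, t1', t2, t2', t3, t3', t4']
    rw [show (b₄ - a₄ - 1).toNat + (a₄ - a₃).toNat + (a₂ + a₃ - a₄ - 1).toNat + ((a₄ - a₁).toNat + r) + r =
        ((b₄ - a₄ - 1).toNat + (a₄ - a₃).toNat + (a₂ + a₃ - a₄ - 1).toNat + (a₄ - a₁).toNat) + 2 * r by ring,
      pow_add, pow_mul, neg_one_sq, one_pow, mul_one]
    ring

/-- **(E2)** `formQTZ â b̂ = Σ_r U_r` at the Whipple partner of Remark-5 data on the cone. -/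
theorem formQTZ_hat (h₁ : a₁ ≤ a₄) (h₂ : a₂ ≤ a₄) (h₃ : a₃ ≤ a₄)
    (hadm : Admissible (firstA a₁ a₂ a₃ a₄) (firstB a₁ a₂ a₄ b₄)) :
    formQTZ (hatA a₁ a₂ a₃ a₄ b₄) (hatB a₁ a₂ a₃ a₄ b₄) =
      ∑ r ∈ range ((b₄ - a₄ - 1).toNat + 1),
        ((Nat.choose ((a₄ - a₁).toNat + (a₄ - a₂).toNat + (a₁ + a₂ - a₄ - 1).toNat + 2 * r)
              ((b₄ - a₄ - 1).toNat + (a₄ - a₃).toNat) : ℕ) : ℤ) *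
          ((Nat.choose (r + ((a₄ - a₂).toNat + (a₂ + a₃ - a₄ - 1).toNat)) (a₂ + a₃ - a₄ - 1).toNat : ℕ) : ℤ) *
          ((Nat.choose ((a₄ - a₁).toNat + (a₁ + a₂ - a₄ - 1).toNat) ((a₄ - a₁).toNat + r) : ℕ) : ℤ) *
          ((Nat.choose (b₄ - a₄ - 1).toNat r : ℕ) : ℤ) := by
  have l00 := hadm.lower 0 (by decide) 0
  have l01 := hadm.lower 0 (by decide) 1
  have l11 := hadm.lower 1 (by decide) 1
  have l22 := hadm.lower 2 (by decide) 2
  have u3 := hadm.upper 3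
  simp only [TwoTaleWhipple.firstA_zero, TwoTaleWhipple.firstA_one, TwoTaleWhipple.firstA_two,
    TwoTaleWhipple.firstA_three, TwoTaleWhipple.firstB_zero, TwoTaleWhipple.firstB_one,
    TwoTaleWhipple.firstB_two, TwoTaleWhipple.firstB_three] at l00 l01 l11 l22 u3
  have hamax : aMax3 (hatA a₁ a₂ a₃ a₄ b₄) = a₄ := by
    simp only [aMax3, TwoTaleWhipple.hatA_one, TwoTaleWhipple.hatA_two, TwoTaleWhipple.hatA_three]
    omega
  have hbmin : bMin (hatB a₁ a₂ a₃ a₄ b₄) = a₄ + (((min (a₁ + a₂) b₄ - a₄).toNat : ℕ) : ℤ) := by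
    simp only [bMin, TwoTaleWhipple.hatB_two, TwoTaleWhipple.hatB_three]
    omega
  have hsign : ((-1 : ℤ) ^ (hatB a₁ a₂ a₃ a₄ b₄ 2 + hatB a₁ a₂ a₃ a₄ b₄ 3).natAbs) *
      (-1) ^ (((b₄ - a₄ - 1).toNat + (a₄ - a₃).toNat) + (a₂ + a₃ - a₄ - 1).toNat + (a₄ - a₁).toNat) = 1 := by
    rw [TwoTaleWhipple.hatB_two, TwoTaleWhipple.hatB_three, ← pow_add,
      show (a₁ + a₂ + b₄).natAbs + ((b₄ - a₄ - 1).toNat + (a₄ - a₃).toNat + (a₂ + a₃ - a₄ - 1).toNat +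
        (a₄ - a₁).toNat) = 2 * (a₂ + b₄ - 1).toNat by omega, pow_mul]
    norm_num
  unfold formQTZ
  rw [hamax, hbmin, sum_Ico_int_eq_sum_range, Finset.mul_sum]
  -- termwise: sign · A_(a₄+r) = U_r
  rw [show ∑ j ∈ range (min (a₁ + a₂) b₄ - a₄).toNat,
        (-1) ^ (hatB a₁ a₂ a₃ a₄ b₄ 2 + hatB a₁ a₂ a₃ a₄ b₄ 3).natAbs *
          coefATZ (hatA a₁ a₂ a₃ a₄ b₄) (hatB a₁ a₂ a₃ a₄ b₄) (a₄ + (j : ℤ)) =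
      ∑ r ∈ range (min (a₁ + a₂) b₄ - a₄).toNat,
        ((Nat.choose ((a₄ - a₁).toNat + (a₄ - a₂).toNat + (a₁ + a₂ - a₄ - 1).toNat + 2 * r)
              ((b₄ - a₄ - 1).toNat + (a₄ - a₃).toNat) : ℕ) : ℤ) *
          ((Nat.choose (r + ((a₄ - a₂).toNat + (a₂ + a₃ - a₄ - 1).toNat)) (a₂ + a₃ - a₄ - 1).toNat : ℕ) : ℤ) *
          ((Nat.choose ((a₄ - a₁).toNat + (a₁ + a₂ - a₄ - 1).toNat) ((a₄ - a₁).toNat + r) : ℕ) : ℤ) *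
          ((Nat.choose (b₄ - a₄ - 1).toNat r : ℕ) : ℤ) from
      Finset.sum_congr rfl fun r _ => by rw [coefATZ_hat h₁ h₂ h₃ hadm r, ← mul_assoc, hsign, one_mul]]
  -- extend the range from `min (a₁+a₂) b₄ − a₄` to `N + 1`: the extra terms vanish (`C(x+e, x+r) = 0`)
  apply Finset.sum_subset
  · intro r hr
    simp only [mem_range] at hr ⊢
    omega
  · intro r hr hr'
    simp only [mem_range, not_lt] at hr hr'
    rw [Nat.choose_eq_zero_of_lt (n := (a₄ - a₁).toNat + (a₁ + a₂ - a₄ - 1).toNat) (by omega)]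
    simp

/-! ### Remark 5 on the cone -/

/-- **Zudilin's Remark 5 PROVED on the cone `a₁, a₂, a₃ ≤ a₄`** [cite: Zudilin2014ZetaTwo, Remark 5;
Slater1966, (2.4.2.3); Bailey1935, §4.5] (Whipple 1926): `q(a; 1, a₄−a₁+1, a₄−a₂+1, b₄) = −q̂(b₄−a₃+a₄; a₂, a₁, a₄; a₄+1;
a₄−a₃+1, a₁+a₂, b₄)` for the Literature's integer mirrors `formQZ` / `formQTZ`. -/
theorem remark5Max (a₁ a₂ a₃ a₄ b₄ : ℤ) (h₁ : a₁ ≤ a₄) (h₂ : a₂ ≤ a₄) (h₃ : a₃ ≤ a₄)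
    (hadm : Admissible (firstA a₁ a₂ a₃ a₄) (firstB a₁ a₂ a₄ b₄)) :
    formQZ (firstA a₁ a₂ a₃ a₄) (firstB a₁ a₂ a₄ b₄) =
      -formQTZ (hatA a₁ a₂ a₃ a₄ b₄) (hatB a₁ a₂ a₃ a₄ b₄) := by
  have l11 := hadm.lower 1 (by decide) 1
  have l22 := hadm.lower 2 (by decide) 2
  simp only [TwoTaleWhipple.firstA_one, TwoTaleWhipple.firstA_two, TwoTaleWhipple.firstB_one,
    TwoTaleWhipple.firstB_two] at l11 l22
  have hz : (a₄ - a₁).toNat + (a₁ + a₂ - a₄ - 1).toNat = (a₄ - a₃).toNat + (a₂ + a₃ - a₄ - 1).toNat := by omega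
  have hW := binomialWhipple (a₄ - a₁).toNat (a₄ - a₂).toNat (a₄ - a₃).toNat (a₁ + a₂ - a₄ - 1).toNat
    (a₂ + a₃ - a₄ - 1).toNat (b₄ - a₄ - 1).toNat hz
  rw [formQZ_first h₁ h₂ h₃ hadm, formQTZ_hat h₁ h₂ h₃ hadm, hW, pow_succ]
  ring

end remark5

end Summit.KontsevichZagierPeriods.Zeta5Search.TwoTaleWhippleRemark5
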